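import Summits.QuantumFields.YangMills.Theorems.BalabanUVNodesN13Cor3AsymJunctionAtRecord13CoPH

/-!
# BalabanUVNodes ∕ N13 — THE N11 → N13 JUNCTION AT NODE 00's STAGE-13 RECORD, PART 2: THE LOWER (2.49) HALF BY NAME ON THE ALL-SMALL HISTORY
# (companion of `…N13Cor3AsymJunctionAtRecord13CoPH` p589816: there §3 `uvIneq_at_record₁₃CoPH_of_gas_asym` asks `h249up` at every `V` — produced by its §4 from dag-n11-w2's
# [III] Thm 2 at the record — and `h249low` only on `{χ_k ≠ 0}`; HERE the `h249low` inequality is produced BY NAME as well, at a configuration whose history is ALL-SMALL)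
# (Track A, DAG node N13 = [B16], edge N11 → N13; cluster K1 — K1⁷ `StabilityBAtRecordR13SepCoPH` = stmt-QuantumFields-20542, helper; seat `pub-ymgap-dag-n13-w3` g0, plan g79
# REBALANCE № 5 consumer cut; 2026-08-28; count-neutral; a separate module because the 400-line lint bars appending to part 1)

HONEST FRAMING.  Count-neutral kernel BOOKKEEPING over landed theorems; nothing of Bałaban's is asserted; [III] Theorem 2 ∕ Corollary 3 are NOT proved — Theorem 2's sentences are
DISPLAYED HYPOTHESES (dag-n11-w2's binders verbatim, evaluated at the background of record `U_k(V)`); the two object-level seams stay DISPLAYED: `hA'eq` («the (1.72) representation's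
completed action at `V` IS print's (2.23) action of record at `U_k(V)` along the history `s`») and `hφ1` («that history is all-small: every cut-off `φ_j ≡ 1`, j ≤ k» — p. 259 «g_j²(x) =
g_j² on the last domain»; whether `χ_k(V) ≠ 0` forces it is WHAT the representation `R` of `densOfRecord₁₃` IS — the K0∕XL core, not claimed).  N11 ∕ N13 NOT discharged; K0⁷ ∕ K1⁷
NOT closed; counts unmoved (discharged 5∕27 · Track A 5∕28).  The Yang–Mills mass gap (Clay) is NOT proved by any of this; rung R4 `BalabanLadder.UV` (conditional finite-𝕋⁴
bookkeeping) is the only thing the K-items close.  ONE finite four-torus programme at fixed `ε = L^{-K}`; nothing continuum ∕ ℝ⁴ ∕ OS.  No `sorry`, `def`, `instance`, `notation`.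

WHAT THIS FILE PROVES (2 theorems).  ★★ `ineq249_at_record₁₃CoPH_of_thm2_of_phi_eq_one_of_aPrimeEq` — (2.49) TWO-SIDED at `V` in the Cor.-3 chain's constant-coupling currency
`(1∕g_k²)·wilsonBGOfRecord`, from n11-w2's `ineq249_action23_at_record₁₃CoPH_of_thm2` at `U := U_k(V)` and the currency identity `smearedWilson_invSq_eq_const_of_phi_eq_one` (part 1's
`ineq249_const_of_smeared_of_eq`, `wilsonAction4_Uk_eq_wilsonBGOfRecord`); `ineq249low_at_record₁₃CoPH_of_thm2_of_phi_eq_one_of_aPrimeEq` — its LOWER half, the inequality part 1 §3's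
`h249low` binder asks on the support.

Sources: [Balaban1988Convergent] Thm 2 (2.43)–(2.44) p.263, (2.45)–(2.50) pp.263–264, (2.24) p.259 and p.259 «last domain»; [Balaban1989LargeFieldII] (1.72) p.379, p.391 (the term
without large-field regions), (0.1) p.356.
-/

noncomputable section

open MeasureTheory
open scoped BigOperators Matrix.Norms.L2Operator

namespace Summit.QuantumFields.YangMills.BalabanUVNodes.N13Cor3AsymJunctionAllSmallAtRecord13CoPH

open Literature.MathematicalPhysics.QuantumFieldTheory.Balaban1983to89 Step B14.Eq225Concrete B14.LocalCoupling B14Thm2 Finset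
open T4Continuum T4DatumAssembly Node00 DagBinding FlowStepRuns
open B16Cor3Ops (Repr172)
open Summit.QuantumFields.YangMills.Theorems.BalabanUVNodesN11Thm2Ineq249AtRecord13CoPH (ineq249_action23_at_record₁₃CoPH_of_thm2
  smearedWilson_invSq_eq_const_of_phi_eq_one)
open Summit.QuantumFields.YangMills.BalabanUVNodes.N13Cor3AsymJunctionAtRecord13CoPH (wilsonAction4_Uk_eq_wilsonBGOfRecord ineq249_const_of_smeared_of_eq
  ineq249low_of_ineq249)

/-! ## §1. THE LOWER HALF BY NAME on the ALL-SMALL history: where every cut-off `φ_j ≡ 1` the smeared and constant currencies coincide (p. 259) -/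

section JunctionAllSmall

variable (F : T4Family) (N : ℕ) [NeZero N]
variable (θ : Stage13HParams F N) (P : B12.RunParams) (k : ℕ)

/-- **★★ (2.49) TWO-SIDED AT `V` IN THE COR.-3 CHAIN's CURRENCY ON THE ALL-SMALL HISTORY, FROM [III] THEOREM 2 AT THE RECORD** (dag-n11-w2's `ineq249_action23_at_record₁₃CoPH_of_thm2`
at `U := U_k(V)`, and the currency identity `smearedWilson_invSq_eq_const_of_phi_eq_one` — p. 259 «g_j²(x) = g_j² on the last domain» — under the displayed all-small hypothesis `hφ1 : φ_j ≡ 1`,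
`j = 1,…,k`, for the history `s`), UNDER the one identification `hA'eq`.  This is the shape §3's `h249low` binder asks on `{χ_k ≠ 0}` (the support where print uses the lower half, p. 391) —
whether the history of such a `V` IS all-small is part of the object-level seam (what `R` is), displayed here as `hφ1`. [cite: Balaban1988Convergent, Thm 2 p.263, (2.49) p.264, p.259; Balaban1989LargeFieldII, (1.72) p.379, p.391 (bookkeeping)] -/
theorem ineq249_at_record₁₃CoPH_of_thm2_of_phi_eq_one_of_aPrimeEq {Dom : Type*} (R : Repr172 (GaugeField (F.P P.K) k (SU N)) Dom)
    (V : GaugeField (F.P P.K) k (SU N))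
    (s : SeqOfRecord F θ.ν θ.τ9.M (gOfRecord₁₃ F N θ.toStage13Params P) P.K k)
    (t : Sect2.TermValues (F.P P.K) (MatA N) (FluctV N) θ.τ9.M) (a : Tk.SFluct (F.P P.K) (FluctV N)) (κ₀ : ℕ) (hκ : 7 ≤ κ₀)
    (Ek EkLog EkRest : ℝ) (hEk : Ek = EkLog + EkRest) (E₁ R₁ B₁ L β E₂ : ℝ) (Γ : ℕ → ℝ)
    (hL : 1 < L) (hβ : 0 < β) (hE : 0 ≤ E₁) (hR : 0 ≤ R₁) (hΓ : ∀ n, 1 ≤ n → n ≤ k → 0 ≤ Γ n)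
    (hφ1 : ∀ j, 1 ≤ j → j ≤ k → ∀ x, θ.Phih P k s.Ω s.Λ j x = 1)
    (h243 : ∀ j, 1 ≤ j → j ≤ k →
      |EjSub (sect2TowerOfRecord F N (FluctV N) P.K (settingOfRecord₁₃ F N θ.toStage13Params P) (θ.rzAt P s) s t)
            (fun j X z => Sect2.admE (F.P P.K) θ.ν θ.τ9.M (gOfRecord₁₃ F N θ.toStage13Params P) s.Λ j (Sect2.domSites (F.P P.K) θ.τ9.M j X) z) j
            (Uk F N P.K k θ.εbg V)
          - (1 / gOfRecord₁₃ F N θ.toStage13Params P (j - 1) ^ 2 - 1 / gOfRecord₁₃ F N θ.toStage13Params P j ^ 2) *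
              smearedWilson (θ.Phih P k s.Ω s.Λ j) (Uk F N P.K k θ.εbg V)| ≤ E₁ * ∑ n ∈ Icc j k, (L ^ ((j : ℝ) - n)) ^ β * Γ n)
    (h244 : ∀ j, 1 ≤ j → j ≤ k →
      |∑ X : (Sect2.domSys (F.P P.K) θ.τ9.M j).Dom, (if Sect2.admR (F.P P.K) θ.ν θ.τ9.M (gOfRecord₁₃ F N θ.toStage13Params P) s.Λ j (Sect2.domSites (F.P P.K) θ.τ9.M j X) then
          ((t.R j X (Sect2.ofBackgroundC (ιSU N) (Uk F N P.K k θ.εbg V))).re - (t.R j X (Sect2.ofBackgroundC (ιSU N) 1)).re) else 0)| ≤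
        R₁ * (gOfRecord₁₃ F N θ.toStage13Params P j) ^ κ₀ * ∑ n ∈ Icc j k, Γ n)
    (hsum : ∀ n, 1 ≤ n → n ≤ k → ∑ j ∈ Icc 1 n, (gOfRecord₁₃ F N θ.toStage13Params P j) ^ κ₀ ≤ (gOfRecord₁₃ F N θ.toStage13Params P n) ^ (κ₀ - 6))
    (hsmall : ∀ n, 1 ≤ n → n ≤ k → R₁ * (gOfRecord₁₃ F N θ.toStage13Params P n) ^ (κ₀ - 6) ≤ 1)
    (h248 : |B240 (sect2TowerOfRecord F N (FluctV N) P.K (settingOfRecord₁₃ F N θ.toStage13Params P) (θ.rzAt P s) s t)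
        (fun j X => Sect2.admB (F.P P.K) θ.ν θ.τ9.M (gOfRecord₁₃ F N θ.toStage13Params P) s.Ω s.Λ j (Sect2.domSites (F.P P.K) θ.τ9.M j X)) a k
        (Uk F N P.K k θ.εbg V)| ≤ 2 * B₁ * ∑ n ∈ Icc 1 k, Γ n)
    (hvac : VacuumRestBound EkRest E₂ Γ k)
    (hA'eq : R.A' V =
      (sect2ActionDataOfRecord F N (FluctV N) P.K (settingOfRecord₁₃ F N θ.toStage13Params P) (θ.rzAt P s) s t a Ek).action23 k (Uk F N P.K k θ.εbg V)) :
    Ineq249 (R.A' V) (1 / (gOfRecord₁₃ F N θ.toStage13Params P k) ^ 2 * wilsonBGOfRecord F N θ.εbg P k V) (-EkLog)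
      (E₁ * (1 - L ^ (-β))⁻¹ + 1 + 2 * B₁ + E₂) Γ k := by
  have h := ineq249_action23_at_record₁₃CoPH_of_thm2 θ P s t a κ₀ hκ Ek EkLog EkRest hEk (Uk F N P.K k θ.εbg V) E₁ R₁ B₁ L β E₂ Γ hL hβ hE hR hΓ
    h243 h244 hsum hsmall h248 hvac
  have heq := smearedWilson_invSq_eq_const_of_phi_eq_one (flowOfRun (gOfRecord₁₃ F N θ.toStage13Params P)) (θ.Phih P k s.Ω s.Λ)
    (flowOfRun_satisfiesRG (gOfRecord₁₃ F N θ.toStage13Params P) k) le_rfl hφ1 (Uk F N P.K k θ.εbg V)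
  rw [hA'eq, ← wilsonAction4_Uk_eq_wilsonBGOfRecord F N P k θ.εbg V]
  exact ineq249_const_of_smeared_of_eq h heq

/-- **The LOWER half at `V` on the all-small history** — the inequality §3's `h249low` binder asks at a configuration of the support, from the previous theorem.
[cite: Balaban1988Convergent, (2.49)–(2.50) p.264; Balaban1989LargeFieldII, p.391 (bookkeeping)] -/
theorem ineq249low_at_record₁₃CoPH_of_thm2_of_phi_eq_one_of_aPrimeEq {Dom : Type*} (R : Repr172 (GaugeField (F.P P.K) k (SU N)) Dom)
    (V : GaugeField (F.P P.K) k (SU N))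
    (s : SeqOfRecord F θ.ν θ.τ9.M (gOfRecord₁₃ F N θ.toStage13Params P) P.K k)
    (t : Sect2.TermValues (F.P P.K) (MatA N) (FluctV N) θ.τ9.M) (a : Tk.SFluct (F.P P.K) (FluctV N)) (κ₀ : ℕ) (hκ : 7 ≤ κ₀)
    (Ek EkLog EkRest : ℝ) (hEk : Ek = EkLog + EkRest) (E₁ R₁ B₁ L β E₂ : ℝ) (Γ : ℕ → ℝ)
    (hL : 1 < L) (hβ : 0 < β) (hE : 0 ≤ E₁) (hR : 0 ≤ R₁) (hΓ : ∀ n, 1 ≤ n → n ≤ k → 0 ≤ Γ n)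
    (hφ1 : ∀ j, 1 ≤ j → j ≤ k → ∀ x, θ.Phih P k s.Ω s.Λ j x = 1)
    (h243 : ∀ j, 1 ≤ j → j ≤ k →
      |EjSub (sect2TowerOfRecord F N (FluctV N) P.K (settingOfRecord₁₃ F N θ.toStage13Params P) (θ.rzAt P s) s t)
            (fun j X z => Sect2.admE (F.P P.K) θ.ν θ.τ9.M (gOfRecord₁₃ F N θ.toStage13Params P) s.Λ j (Sect2.domSites (F.P P.K) θ.τ9.M j X) z) j
            (Uk F N P.K k θ.εbg V)
          - (1 / gOfRecord₁₃ F N θ.toStage13Params P (j - 1) ^ 2 - 1 / gOfRecord₁₃ F N θ.toStage13Params P j ^ 2) *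
              smearedWilson (θ.Phih P k s.Ω s.Λ j) (Uk F N P.K k θ.εbg V)| ≤ E₁ * ∑ n ∈ Icc j k, (L ^ ((j : ℝ) - n)) ^ β * Γ n)
    (h244 : ∀ j, 1 ≤ j → j ≤ k →
      |∑ X : (Sect2.domSys (F.P P.K) θ.τ9.M j).Dom, (if Sect2.admR (F.P P.K) θ.ν θ.τ9.M (gOfRecord₁₃ F N θ.toStage13Params P) s.Λ j (Sect2.domSites (F.P P.K) θ.τ9.M j X) then
          ((t.R j X (Sect2.ofBackgroundC (ιSU N) (Uk F N P.K k θ.εbg V))).re - (t.R j X (Sect2.ofBackgroundC (ιSU N) 1)).re) else 0)| ≤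
        R₁ * (gOfRecord₁₃ F N θ.toStage13Params P j) ^ κ₀ * ∑ n ∈ Icc j k, Γ n)
    (hsum : ∀ n, 1 ≤ n → n ≤ k → ∑ j ∈ Icc 1 n, (gOfRecord₁₃ F N θ.toStage13Params P j) ^ κ₀ ≤ (gOfRecord₁₃ F N θ.toStage13Params P n) ^ (κ₀ - 6))
    (hsmall : ∀ n, 1 ≤ n → n ≤ k → R₁ * (gOfRecord₁₃ F N θ.toStage13Params P n) ^ (κ₀ - 6) ≤ 1)
    (h248 : |B240 (sect2TowerOfRecord F N (FluctV N) P.K (settingOfRecord₁₃ F N θ.toStage13Params P) (θ.rzAt P s) s t)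
        (fun j X => Sect2.admB (F.P P.K) θ.ν θ.τ9.M (gOfRecord₁₃ F N θ.toStage13Params P) s.Ω s.Λ j (Sect2.domSites (F.P P.K) θ.τ9.M j X)) a k
        (Uk F N P.K k θ.εbg V)| ≤ 2 * B₁ * ∑ n ∈ Icc 1 k, Γ n)
    (hvac : VacuumRestBound EkRest E₂ Γ k)
    (hA'eq : R.A' V =
      (sect2ActionDataOfRecord F N (FluctV N) P.K (settingOfRecord₁₃ F N θ.toStage13Params P) (θ.rzAt P s) s t a Ek).action23 k (Uk F N P.K k θ.εbg V)) :
    -((E₁ * (1 - L ^ (-β))⁻¹ + 1 + 2 * B₁ + E₂) * ∑ n ∈ Icc 1 k, Γ n) ≤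
      R.A' V + 1 / (gOfRecord₁₃ F N θ.toStage13Params P k) ^ 2 * wilsonBGOfRecord F N θ.εbg P k V - (-EkLog) :=
  ineq249low_of_ineq249 (ineq249_at_record₁₃CoPH_of_thm2_of_phi_eq_one_of_aPrimeEq F N θ P k R V s t a κ₀ hκ Ek EkLog EkRest hEk E₁ R₁ B₁ L β E₂ Γ
    hL hβ hE hR hΓ hφ1 h243 h244 hsum hsmall h248 hvac hA'eq)

end JunctionAllSmall

end Summit.QuantumFields.YangMills.BalabanUVNodes.N13Cor3AsymJunctionAllSmallAtRecord13CoPH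

end
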